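import Summits.AtomisticToContinuum.FouriersLaw.Theses.ContactStieltjesMeasure
import Literature.MathematicalPhysics.KineticTheory.LangevinChainKernel

/-!
# Sketch — first lemmas of the crux ideas for `StieltjesRepresentation` (stmt-AtomisticToContinuum-15248)

crux-ideate round 1, ideator k = 2.  Two cards:

* `poisson-clock-renewal`  — friction as a Poisson REFRESH RATE: renewal over the isolated chain's Koopman
  group gives an accretive pseudo-resolvent in the rate with NO unbounded dissipative operator; Stieltjes for
  every clock step `s`, Langevin as the clock limit `s ↓ 0` (first lemma `PoissonClockPencils`).
* `accretive-abel-pencil`  — the Stieltjes shape needs only the dissipation INEQUALITY (E≤), which survives a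
  positive Abel parameter `η`; so the pencil can be the honest bounded family `S^{1/2}(η - L_γ)⁻¹S^{1/2}` and
  `η ↓ 0` is a scalar Helly limit (first lemma `AccretivePencilStieltjes`, physical side `AbelPencilsOfGreenKubo`).

All statements are `Prop`s over existing declarations; nothing is proved here.
-/

noncomputable section

open scoped NNReal ENNReal Topology BigOperators
open MeasureTheory Filter Set
open Literature.MathematicalPhysics.KineticTheory.HeatConduction

namespace Summit.AtomisticToContinuum.FouriersLaw.Cruxes.StieltjesRepresentation.IdeasK2

/-- ABSTRACT ENGINE (card `accretive-abel-pencil`, first lemma; also the engine of `poisson-clock-renewal`):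
the landed `stub_stieltjesOfPencil` with the energy IDENTITY (E) weakened to the dissipation INEQUALITY
(E≤) `γ‖W γ f‖² ≤ ⟪f, W γ f⟫`.  Then `C = 2W(1) - 1` is a CONTRACTION (not an isometry) and the Poisson means of
`c_k = ⟪C^k g, g⟫` are still nonnegative: `Σ_k r^{|k|} c_{|k|} cos kθ = lim (‖S_M‖² - r²‖C S_M‖²) ≥ 0`; the rest of
the landed proof (Herglotz by Fejér/Prokhorov, Poisson closed form, layer cake, mass `c_0 = ‖g‖²`) is unchanged. -/
def AccretivePencilStieltjes : Prop :=
  ∀ (K : Type) [NormedAddCommGroup K] [InnerProductSpace ℝ K] (W : ℝ → K →L[ℝ] K),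
    (∀ γ γ' : ℝ, 0 < γ → 0 < γ' → ∀ f : K, W γ f - W γ' f = (γ' - γ) • W γ (W γ' f)) →
    (∀ γ : ℝ, 0 < γ → ∀ f : K, γ * ‖W γ f‖ ^ 2 ≤ inner ℝ f (W γ f)) →
    ∀ g : K, ∃ Φ : ℝ → ℝ, Monotone Φ ∧ (∀ s : ℝ, s ≤ 0 → Φ s = 0) ∧ (∀ s : ℝ, Φ s ≤ ‖g‖ ^ 2) ∧
      ∀ γ : ℝ, 0 < γ → inner ℝ g (W γ g) = γ * ∫ t in Set.Ioi (0 : ℝ), Φ t * (2 * t / (γ ^ 2 + t ^ 2) ^ 2)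

/-- CLOSEDNESS OF THE STIELTJES CLASS UNDER POINTWISE LIMITS WITH A MASS BOUND (shared support lemma of both
cards; Helly selection / Prokhorov on the Cayley circle): if `F_n(γ) = γ∫₀^∞ Φ_n(t)·2t/(γ²+t²)² dt` with `Φ_n`
monotone, `0` on `(-∞,0]`, `Φ_n ≤ M`, and `F_n → F` pointwise on `(0,∞)`, then `F` has the same form. -/
def StieltjesClassClosed : Prop :=
  ∀ (M : ℝ) (Φ : ℕ → ℝ → ℝ) (F : ℝ → ℝ),
    (∀ n, Monotone (Φ n)) → (∀ n, ∀ s : ℝ, s ≤ 0 → Φ n s = 0) → (∀ n, ∀ s : ℝ, Φ n s ≤ M) →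
    (∀ γ : ℝ, 0 < γ → Tendsto (fun n => γ * ∫ t in Set.Ioi (0 : ℝ), Φ n t * (2 * t / (γ ^ 2 + t ^ 2) ^ 2))
      atTop (𝓝 (F γ))) →
    ∃ Ψ : ℝ → ℝ, Monotone Ψ ∧ (∀ s : ℝ, s ≤ 0 → Ψ s = 0) ∧ (∀ s : ℝ, Ψ s ≤ M) ∧
      ∀ γ : ℝ, 0 < γ → F γ = γ * ∫ t in Set.Ioi (0 : ℝ), Ψ t * (2 * t / (γ ^ 2 + t ^ 2) ^ 2)

/-- PHYSICAL SIDE of card `accretive-abel-pencil`: for EVERY Abel parameter `η > 0` (and the CLOSED parameter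
range `lam, β ≥ 0`: no ergodicity is used) there is an accretive pencil — intended witness `K = L²(μ_T)`,
`W_η(γ) = S^{1/2}(η - L_γ)⁻¹S^{1/2}`, `g = g₀/T` (`S g₀ = g₀`) — whose diagonal element is the `η`-LAPLACE
TRANSFORM of the boundary-power autocorrelation: `⟪g, W γ g⟫ = (∫₀^∞ e^{-ηt} corr_γ(t) dt)/T²`. The only Langevin
input is the energy identity of the TRUE `L²` generator at `η > 0` (Markov uniqueness on `C_c^∞`); no decay of
correlations, no `ν ↓ 0` strong limits. -/
def AbelPencilsOfGreenKubo : Prop :=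
  ∀ ω₂ lam β : ℝ, 0 < ω₂ → 0 ≤ lam → 0 ≤ β → ∀ T : ℝ, 0 < T → ∀ η : ℝ, 0 < η → ∀ (N : ℕ) (hN : 2 ≤ N),
    ∃ (K : Type) (_ : NormedAddCommGroup K) (_ : InnerProductSpace ℝ K) (W : ℝ → K →L[ℝ] K) (g : K),
      (∀ γ γ' : ℝ, 0 < γ → 0 < γ' → ∀ f : K, W γ f - W γ' f = (γ' - γ) • W γ (W γ' f)) ∧
      (∀ γ : ℝ, 0 < γ → ∀ f : K, γ * ‖W γ f‖ ^ 2 ≤ inner ℝ f (W γ f)) ∧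
      ∀ γ : ℝ, 0 < γ →
        let P := pinnedChain ω₂ lam β γ
        let X := PhaseSpace N
        let μ : Measure X := P.gibbsMeasure N T
        let g₀ : X → ℝ := fun z => z.2 ⟨0, by omega⟩ * partialQ ⟨0, by omega⟩ (P.hamiltonian N) z
        let corr : ℝ → ℝ := fun t =>
          (∫ z, g₀ z * (∫ y, g₀ y ∂(P.transitionKernel N T T t.toNNReal z)) ∂μ) -
            (∫ z, g₀ z ∂μ) * (∫ z, g₀ z ∂μ)
        ‖g‖ ^ 2 ≤ (∫ z, g₀ z ^ 2 ∂μ) / T ^ 2 ∧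
          inner ℝ g (W γ g) = (∫ t in Set.Ioi (0 : ℝ), Real.exp (-(η * t)) * corr t) / T ^ 2

/-- FIRST LEMMA of card `poisson-clock-renewal`: for every Abel parameter `η > 0` (closed range `lam, β ≥ 0`) a
SEQUENCE of accretive pencils — intended witnesses: the Poisson-clock chains with clock step `s_n ↓ 0` (Hamiltonian
flow of the ISOLATED chain + Mehler refresh `p_b ↦ e^{-s}p_b + √(1-e^{-2s})√T ξ` of both boundary momenta at Poisson
rate `γ/s`), `W_n(γ) = s⁻¹·(1-Q_s)^{1/2}(η + (γ/s)(1-Q_s) - A)⁻¹(1-Q_s)^{1/2}` built by the RENEWAL SERIES over the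
Koopman resolvent of the flow (bounded operators only; (R) and the exact energy identity `⟪f,x⟫ = η‖x‖² +
(γ/s)⟪x,(1-Q_s)x⟫` by algebra), `g_n = √(s/(1-e^{-s}))·g₀/T` (`(1-Q_s)g₀ = (1-e^{-s})g₀`) — whose diagonal
elements CONVERGE, at every friction, to the `η`-Laplace transform of the Langevin boundary-power autocorrelation
(clock limit `s·N_{γ/s}(t) → γt`: the Langevin chain is the Poisson-clock chain with the staircase bath clock
replaced by its mean). With `AccretivePencilStieltjes` + `StieltjesClassClosed` (twice: `n → ∞`, then `η ↓ 0` by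
dominated convergence from `corr ∈ L¹`) + the boundary Green–Kubo stub this gives the crux on `lam, β > 0`. -/
def PoissonClockPencils : Prop :=
  ∀ ω₂ lam β : ℝ, 0 < ω₂ → 0 ≤ lam → 0 ≤ β → ∀ T : ℝ, 0 < T → ∀ η : ℝ, 0 < η → ∀ (N : ℕ) (hN : 2 ≤ N),
    ∃ (K : Type) (_ : NormedAddCommGroup K) (_ : InnerProductSpace ℝ K) (W : ℕ → ℝ → K →L[ℝ] K) (g : ℕ → K),
      (∀ n, ∀ γ γ' : ℝ, 0 < γ → 0 < γ' → ∀ f : K, W n γ f - W n γ' f = (γ' - γ) • W n γ (W n γ' f)) ∧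
      (∀ n, ∀ γ : ℝ, 0 < γ → ∀ f : K, γ * ‖W n γ f‖ ^ 2 ≤ inner ℝ f (W n γ f)) ∧
      ∀ γ : ℝ, 0 < γ →
        let P := pinnedChain ω₂ lam β γ
        let X := PhaseSpace N
        let μ : Measure X := P.gibbsMeasure N T
        let g₀ : X → ℝ := fun z => z.2 ⟨0, by omega⟩ * partialQ ⟨0, by omega⟩ (P.hamiltonian N) z
        let corr : ℝ → ℝ := fun t =>
          (∫ z, g₀ z * (∫ y, g₀ y ∂(P.transitionKernel N T T t.toNNReal z)) ∂μ) -
            (∫ z, g₀ z ∂μ) * (∫ z, g₀ z ∂μ)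
        (∀ n, ‖g n‖ ^ 2 ≤ 2 * (∫ z, g₀ z ^ 2 ∂μ) / T ^ 2) ∧
          Tendsto (fun n => inner ℝ (g n) (W n γ (g n))) atTop
            (𝓝 ((∫ t in Set.Ioi (0 : ℝ), Real.exp (-(η * t)) * corr t) / T ^ 2))

/-- ABSTRACT RENEWAL PENCIL (the bounded-operator heart of `poisson-clock-renewal`, stated without processes):
a strongly measurable ISOMETRIC semigroup `U` (the Koopman semigroup of a measure-preserving flow), a symmetric `Q`
with `0 ≤ Q ≤ 1` (the Mehler refresh) and a killing `η > 0` give, for every rate `λ > 0`, the renewal resolvent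
`R(λ) = Σ_k V(η+λ)[λ Q V(η+λ)]^k`, `V(ζ) = ∫₀^∞ e^{-ζt}U_t dt`, with the EXACT energy identity
`⟪f, R λ f⟫ = η‖R λ f‖² + λ⟪R λ f, (1-Q)(R λ f)⟫` and the cross-rate resolvent identity — hence an accretive pencil
`W(λ) = (1-Q)^{1/2}R(λ)(1-Q)^{1/2}` in the RATE.  Stated here for an eigenvector `u` of `1 - Q` (no square root
needed on the diagonal): the scalar `λ ↦ ⟪u, R λ u⟫` is `λ ×` Stieltjes(`λ²`) with mass `≤ ‖u‖²/c`. -/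
def RenewalPencilStieltjes : Prop :=
  ∀ (K : Type) [NormedAddCommGroup K] [InnerProductSpace ℝ K] [CompleteSpace K]
    (U : ℝ → K →L[ℝ] K) (Q : K →L[ℝ] K) (η : ℝ) (u : K) (c : ℝ),
    (∀ t, 0 ≤ t → ∀ f : K, ‖U t f‖ = ‖f‖) → (U 0 = ContinuousLinearMap.id ℝ K) →
    (∀ s t, 0 ≤ s → 0 ≤ t → U (s + t) = (U s).comp (U t)) →
    (∀ f : K, Continuous fun t => U t f) →
    (∀ f h : K, inner ℝ f (Q h) = inner ℝ (Q f) h) → (∀ f : K, 0 ≤ inner ℝ f (Q f)) →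
    (∀ f : K, inner ℝ f (Q f) ≤ ‖f‖ ^ 2) →
    0 < η → 0 < c → Q u = (1 - c) • u →
    ∃ Φ : ℝ → ℝ, Monotone Φ ∧ (∀ s : ℝ, s ≤ 0 → Φ s = 0) ∧ (∀ s : ℝ, Φ s ≤ ‖u‖ ^ 2 / c) ∧
      ∀ lam : ℝ, 0 < lam →
        -- the renewal resolvent applied to `u`, as the unique fixed point `x = V(η+lam)(u + lam • Q x)` with
        -- `V(ζ) f = ∫₀^∞ e^{-ζ t} U_t f dt`; written through its defining equation to avoid new definitions:
        ∀ x : K, x = (∫ t in Set.Ioi (0 : ℝ), Real.exp (-((η + lam) * t)) • U t (u + lam • Q x)) →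
          inner ℝ u x = lam * ∫ t in Set.Ioi (0 : ℝ), Φ t * (2 * t / (lam ^ 2 + t ^ 2) ^ 2)

end Summit.AtomisticToContinuum.FouriersLaw.Cruxes.StieltjesRepresentation.IdeasK2

end
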